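import Summits.Schanuel.Schanuel.Theorems.ZilberEacRamifiedLabels
import Summits.Schanuel.Schanuel.Theorems.ZilberEacBranchAlgebraic
import Summits.Schanuel.Schanuel.Theorems.ZilberEacPolarCorrection
import HarnessLib

/-!
# The equimodular class, LVII: the ANALYTIC CHART of a ramified cycle at infinity and the Laurent
# part of a polynomial along a pole of order `k`

HONEST FRAMING.  Cell `pub-schanuel` (Zilber's Exponential-Algebraic Closedness, case ladder;
host summit Schanuel), seat 2, gen 26.  Gen 25 (file LIII) parametrised the `k`-cycle of branches of
a fibre curve at infinity through a `k`-fold top-row root `θ = e^τ` as `x₀ = s^{-k}`, `y₀ = ψ(s)`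
(`ψ` analytic at `0`, `ψ(0) = θ`).  Along such a branch the exponential points `e^{x₀} = y₀` are
`s^{-k} - Λ(s) ∈ τ + 2πiℤ` with `Λ = log(ψ/θ)`.  This file supplies the two elementary analytic
bricks of gen 26:
* **`exists_ramifiedChart`** — an analytic `m` with `m(0) = 0`, `m'(0) ≠ 0` and, for small `s ≠ 0`,
  `2πi · m(s)^{-k} = s^{-k} - log(ψ(s)/θ) - τ` (so the exponential point with LABEL `n` on the
  cycle is `m(s) = n^{-1/k}`: the label equation is solved by INVERTING `m`, file LVIII — no zero
  counting); `m = c·σ·(1 - τσ^k)^{-1/k}`, `σ = s(1 - s^kΛ)^{-1/k}`, `c^k = 2πi`, with the principal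
  `k`-th roots of file LVI (`kthRoot_spec`);
* **`exists_taylor_split_coeff`**, **`exists_laurentPart`** — for `U` analytic at `0` and `p ∈ ℂ[X]`:
  `p(U(μ) μ^{-k}) = Π(μ⁻¹) + r(μ)` with `Π ∈ ℂ[X]` of degree `≤ k·deg p`, top coefficient
  `lc(p)·U(0)^{deg p}`, and `r` analytic at `0` (the Taylor split of file XIII with its top
  coefficient recorded).
[folklore]; nothing here is specific to Schanuel's conjecture (neither used nor implied);
Mantova–Masser's question (PLMS 2024 §1 p. 5) and EC(3,2) stay OPEN.
-/

noncomputable section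

open Filter Topology Polynomial Complex

set_option linter.dupNamespace false

namespace Summit.Schanuel.Schanuel.Theorems

/-! ## Part A. The Laurent part of `p(U(μ) μ^{-k})` -/

/-- **Taylor split with the top coefficient.**  For `G` analytic at `0` and `n : ℕ`:
`G(v)·(v⁻¹)ⁿ = s(v⁻¹) + R(v)` for all `v ≠ 0`, with `deg s ≤ n`, `[Xⁿ]s = G(0)` and `R` analytic at
`0`. [folklore] -/
theorem exists_taylor_split_coeff {G : ℂ → ℂ} (hG : AnalyticAt ℂ G 0) (n : ℕ) :
    ∃ (s : ℂ[X]) (R : ℂ → ℂ), s.natDegree ≤ n ∧ s.coeff n = G 0 ∧ AnalyticAt ℂ R 0 ∧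
      ∀ v : ℂ, v ≠ 0 → G v * v⁻¹ ^ n = s.eval v⁻¹ + R v := by
  rcases n with _ | n
  · refine ⟨Polynomial.C (G 0), fun v => G v - G 0, (Polynomial.natDegree_C _).le,
      Polynomial.coeff_C_zero, hG.sub analyticAt_const, fun v _ => ?_⟩
    rw [pow_zero, mul_one, Polynomial.eval_C]
    ring
  · have hG₁ : AnalyticAt ℂ (dslope G 0) 0 := by
      obtain ⟨q, hq⟩ := hG
      exact ⟨_, hq.has_fpower_series_dslope_fslope⟩
    obtain ⟨s₁, R₁, hs₁, hR₁, hid₁⟩ := exists_taylor_split hG₁ n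
    refine ⟨Polynomial.C (G 0) * Polynomial.X ^ (n + 1) + s₁, R₁, ?_, ?_, hR₁, fun v hv => ?_⟩
    · refine (Polynomial.natDegree_add_le _ _).trans (max_le ?_ (hs₁.trans (Nat.le_succ n)))
      exact Polynomial.natDegree_C_mul_X_pow_le _ _
    · rw [Polynomial.coeff_add, Polynomial.coeff_C_mul_X_pow, if_pos rfl,
        Polynomial.coeff_eq_zero_of_natDegree_lt (Nat.lt_succ_of_le hs₁), add_zero]
    · have hvv : v * v⁻¹ = 1 := mul_inv_cancel₀ hv
      rw [eq_add_mul_dslope G v, Polynomial.eval_add, Polynomial.eval_mul, Polynomial.eval_C,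
        Polynomial.eval_pow, Polynomial.eval_X, pow_succ]
      linear_combination hid₁ v hv + dslope G 0 v * v⁻¹ ^ n * hvv

/-- **The Laurent part along a pole of order `k`.**  For `p ∈ ℂ[X]`, `U` analytic at `0` and `k`:
`p(U(μ)·(μ⁻¹)^k) = Π(μ⁻¹) + r(μ)` for all `μ ≠ 0`, where `Π ∈ ℂ[X]` has degree `≤ k·deg p` and
`[X^{k deg p}]Π = lc(p)·U(0)^{deg p}`, and `r` is analytic at `0`. [folklore] -/
theorem exists_laurentPart (p : ℂ[X]) {U : ℂ → ℂ} (hU : AnalyticAt ℂ U 0) {k : ℕ} (hk : 1 ≤ k) :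
    ∃ (Pl : ℂ[X]) (r : ℂ → ℂ), Pl.natDegree ≤ k * p.natDegree ∧
      Pl.coeff (k * p.natDegree) = p.leadingCoeff * U 0 ^ p.natDegree ∧ AnalyticAt ℂ r 0 ∧
      ∀ μ : ℂ, μ ≠ 0 → p.eval (U μ * μ⁻¹ ^ k) = Pl.eval μ⁻¹ + r μ := by
  classical
  set d := p.natDegree with hd
  have hsplit : ∀ j : ℕ, ∃ (s : ℂ[X]) (R : ℂ → ℂ), s.natDegree ≤ k * j ∧
      s.coeff (k * j) = p.coeff j * U 0 ^ j ∧ AnalyticAt ℂ R 0 ∧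
      ∀ v : ℂ, v ≠ 0 → p.coeff j * U v ^ j * v⁻¹ ^ (k * j) = s.eval v⁻¹ + R v := fun j =>
    exists_taylor_split_coeff (analyticAt_const.mul (hU.pow j)) (k * j)
  choose s R hs hsc hR hid using hsplit
  refine ⟨∑ j ∈ Finset.range (d + 1), s j, fun μ => ∑ j ∈ Finset.range (d + 1), R j μ, ?_, ?_,
    Finset.analyticAt_fun_sum _ fun j _ => hR j, fun μ hμ => ?_⟩
  · refine Polynomial.natDegree_sum_le_of_forall_le _ _ fun j hj => (hs j).trans ?_
    exact Nat.mul_le_mul_left k (Nat.lt_succ_iff.1 (Finset.mem_range.1 hj))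
  · rw [Polynomial.finsetSum_coeff, Finset.sum_eq_single_of_mem d
      (Finset.mem_range.2 (Nat.lt_succ_self d))]
    · rw [hsc, Polynomial.leadingCoeff, hd]
    · intro j hj hjd
      have hjd' : j < d := lt_of_le_of_ne (Nat.lt_succ_iff.1 (Finset.mem_range.1 hj)) hjd
      refine Polynomial.coeff_eq_zero_of_natDegree_lt ((hs j).trans_lt ?_)
      exact Nat.mul_lt_mul_of_pos_left hjd' hk
  · rw [Polynomial.eval_eq_sum_range, Polynomial.eval_finsetSum, ← Finset.sum_add_distrib]
    refine Finset.sum_congr rfl fun j _ => ?_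
    rw [← hid j μ hμ, mul_pow, pow_mul]
    ring

/-! ## Part B. The analytic chart of a ramified cycle -/

/-- `‖x - 1‖ < 1/2` and `x = y` transported: a quotient close to `1` lies in the slit plane and has
small logarithm: `‖log x‖ < 1` whenever `‖x - 1‖ < 1/2`. [folklore] -/
theorem norm_log_lt_one_of_norm_sub_one_lt {x : ℂ} (hx : ‖x - 1‖ < 1 / 2) : ‖Complex.log x‖ < 1 := by
  have h := Complex.norm_log_one_add_half_le_self (z := x - 1) hx.le
  rw [add_sub_cancel] at h
  linarith

/-- **The analytic chart of a ramified cycle at infinity.**  `ψ` analytic at `0` with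
`ψ(0) = θ ≠ 0`, `τ ∈ ℂ` (in the application `e^τ = θ`), `k ≥ 1`.  There is `m` analytic at `0` with `m(0) = 0`, `m'(0) ≠ 0`, such that
for all small `s`: `ψ` is analytic and nonzero at `s`, `ψ(s)/θ` lies in the slit plane with
`‖log(ψ(s)/θ)‖ < 1`, and for `s ≠ 0`: `m(s) ≠ 0` and
`2πi · (m(s)^k)⁻¹ = (s^k)⁻¹ - log(ψ(s)/θ) - τ`. [folklore] (new in this form) -/
theorem exists_ramifiedChart {ψ : ℂ → ℂ} (hψ : AnalyticAt ℂ ψ 0) {θ : ℂ} (hθ0 : θ ≠ 0)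
    (hψ0 : ψ 0 = θ) (τ : ℂ) {k : ℕ} (hk : 1 ≤ k) :
    ∃ m : ℂ → ℂ, AnalyticAt ℂ m 0 ∧ m 0 = 0 ∧ deriv m 0 ≠ 0 ∧
      ∀ᶠ s in 𝓝 (0 : ℂ), AnalyticAt ℂ ψ s ∧ ψ s ≠ 0 ∧ ψ s / θ ∈ Complex.slitPlane ∧
        ‖Complex.log (ψ s / θ)‖ < 1 ∧
        (s ≠ 0 → m s ≠ 0 ∧
          (2 * Real.pi * I) * (m s ^ k)⁻¹ = (s ^ k)⁻¹ - Complex.log (ψ s / θ) - τ) := by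
  have hkC : (k : ℂ) ≠ 0 := Nat.cast_ne_zero.2 (by omega)
  -- the principal `k`-th root `g(v) = (1 + v)^{-1/k}`
  set g : ℂ → ℂ := fun v => Complex.exp (-(1 / (k : ℂ)) * Complex.log (1 + v)) with hg
  have hgan : ∀ v : ℂ, ‖v‖ < 1 → AnalyticAt ℂ g v := fun v hv =>
    (analyticAt_const.mul ((analyticAt_const.add analyticAt_id).clog
      (Complex.mem_slitPlane_of_norm_lt_one hv))).cexp
  have hg0 : g 0 = 1 := by simp [hg]
  have hgne : ∀ v, g v ≠ 0 := fun v => Complex.exp_ne_zero _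
  -- the logarithm `Λ = log(ψ/θ)`
  set Λ : ℂ → ℂ := fun s => Complex.log (ψ s / θ) with hΛ
  have hquot : ContinuousAt (fun s => ψ s / θ) 0 := hψ.continuousAt.div_const θ
  have hquot0 : ψ 0 / θ = 1 := by rw [hψ0, div_self hθ0]
  have hnear₁ : ∀ᶠ s in 𝓝 (0 : ℂ), ‖ψ s / θ - 1‖ < 1 / 2 := by
    have h := hquot.tendsto
    rw [hquot0] at h
    have := (Metric.tendsto_nhds.1 h) (1 / 2) (by norm_num)
    filter_upwards [this] with s hs
    rwa [dist_eq_norm] at hs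
  have hΛan : ∀ s : ℂ, AnalyticAt ℂ ψ s → ‖ψ s / θ - 1‖ < 1 / 2 → AnalyticAt ℂ Λ s := fun s hs h =>
    hs.div_const.clog (mem_slitPlane_of_norm_sub_one_lt h)
  have hΛan0 : AnalyticAt ℂ Λ 0 := hΛan 0 hψ (by rw [hquot0, sub_self, norm_zero]; norm_num)
  have hΛ0 : Λ 0 = 0 := by simp [hΛ, hquot0]
  -- `σ = s · g(v₁ s)`, `v₁ = -s^k Λ`, and the constant `c` with `c^k = 2πi`
  set v₁ : ℂ → ℂ := fun s => -(s ^ k * Λ s) with hv₁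
  have hv₁an : AnalyticAt ℂ v₁ 0 := ((analyticAt_id.pow k).mul hΛan0).neg
  have hv₁0 : v₁ 0 = 0 := by simp [hv₁, hΛ0]
  set σ : ℂ → ℂ := fun s => s * g (v₁ s) with hσ
  set c : ℂ := Complex.exp ((1 / (k : ℂ)) * Complex.log (2 * Real.pi * I)) with hc
  have hc0 : c ≠ 0 := Complex.exp_ne_zero _
  have h2πI : (2 * Real.pi * I : ℂ) ≠ 0 := by
    simp [Real.pi_ne_zero, Complex.I_ne_zero]
  have hck : c ^ k = 2 * Real.pi * I := by
    rw [hc, ← Complex.exp_nat_mul, ← mul_assoc, show ((k : ℂ)) * (1 / (k : ℂ)) = 1 by field_simp,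
      one_mul, Complex.exp_log h2πI]
  have hg₁an : AnalyticAt ℂ (fun s => g (v₁ s)) 0 :=
    (hgan _ (by rw [hv₁0, norm_zero]; exact one_pos)).comp hv₁an
  have hσan : AnalyticAt ℂ σ 0 := analyticAt_id.mul hg₁an
  have hσ0 : σ 0 = 0 := by simp [hσ]
  set v₂ : ℂ → ℂ := fun s => -(τ * σ s ^ k) with hv₂
  have hv₂an : AnalyticAt ℂ v₂ 0 := (analyticAt_const.mul (hσan.pow k)).neg
  have hv₂0 : v₂ 0 = 0 := by simp [hv₂, hσ0, zero_pow (by omega : k ≠ 0)]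
  have hg₂an : AnalyticAt ℂ (fun s => g (v₂ s)) 0 :=
    (hgan _ (by rw [hv₂0, norm_zero]; exact one_pos)).comp hv₂an
  -- `m = s · F(s)`, `F = c g(v₁) g(v₂)`, `F(0) = c`
  set F : ℂ → ℂ := fun s => c * g (v₁ s) * g (v₂ s) with hF
  have hFan : AnalyticAt ℂ F 0 := (analyticAt_const.mul hg₁an).mul hg₂an
  have hF0 : F 0 = c := by simp [hF, hv₁0, hv₂0, hg0]
  set m : ℂ → ℂ := fun s => s * F s with hm
  have hman : AnalyticAt ℂ m 0 := analyticAt_id.mul hFan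
  have hm0 : m 0 = 0 := by simp [hm]
  have hderiv : deriv m 0 = c := by
    rw [hm, deriv_fun_mul differentiableAt_fun_id hFan.differentiableAt]
    simp [hF0]
  -- smallness of the inner arguments near `0`
  have hsmall₁ : ∀ᶠ s in 𝓝 (0 : ℂ), ‖v₁ s‖ < 1 := by
    have h := hv₁an.continuousAt.tendsto
    rw [hv₁0] at h
    have := (Metric.tendsto_nhds.1 h) 1 one_pos
    filter_upwards [this] with s hs
    rwa [dist_zero_right] at hs
  have hsmall₂ : ∀ᶠ s in 𝓝 (0 : ℂ), ‖v₂ s‖ < 1 := by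
    have h := hv₂an.continuousAt.tendsto
    rw [hv₂0] at h
    have := (Metric.tendsto_nhds.1 h) 1 one_pos
    filter_upwards [this] with s hs
    rwa [dist_zero_right] at hs
  refine ⟨m, hman, hm0, by rw [hderiv]; exact hc0, ?_⟩
  filter_upwards [hψ.eventually_analyticAt, hnear₁, hsmall₁, hsmall₂] with s hsan hs1 hw₁ hw₂
  have hψs0 : ψ s ≠ 0 := by
    intro h0
    rw [h0, zero_div, zero_sub, norm_neg, norm_one] at hs1
    norm_num at hs1
  have hslit : ψ s / θ ∈ Complex.slitPlane := mem_slitPlane_of_norm_sub_one_lt hs1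
  refine ⟨hsan, hψs0, hslit, norm_log_lt_one_of_norm_sub_one_lt hs1, fun hs0 => ?_⟩
  -- the two `k`-th root identities
  have hroot₁ := kthRoot_spec hk hw₁
  have hroot₂ := kthRoot_spec hk hw₂
  change g (v₁ s) ^ k * (1 + v₁ s) = 1 at hroot₁
  change g (v₂ s) ^ k * (1 + v₂ s) = 1 at hroot₂
  have hsk : s ^ k ≠ 0 := pow_ne_zero _ hs0
  have hσs : σ s ≠ 0 := mul_ne_zero hs0 (hgne _)
  have hσk : σ s ^ k ≠ 0 := pow_ne_zero _ hσs
  have hms : m s ≠ 0 := mul_ne_zero hs0 (mul_ne_zero (mul_ne_zero hc0 (hgne _)) (hgne _))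
  refine ⟨hms, ?_⟩
  -- `σ^k (1 - s^k Λ) = s^k`
  have hσid : σ s ^ k * (1 - s ^ k * Λ s) = s ^ k := by
    have e1 : σ s ^ k = s ^ k * g (v₁ s) ^ k := by rw [hσ]; ring
    have e2 : (1 : ℂ) - s ^ k * Λ s = 1 + v₁ s := by rw [hv₁]; ring
    rw [e1, e2]
    linear_combination s ^ k * hroot₁
  -- `m^k (1 - τ σ^k) = 2πi σ^k`
  have hmid : m s ^ k * (1 - τ * σ s ^ k) = (2 * Real.pi * I) * σ s ^ k := by
    have e1 : m s ^ k = c ^ k * σ s ^ k * g (v₂ s) ^ k := by rw [hm, hF, hσ]; ring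
    have e2 : (1 : ℂ) - τ * σ s ^ k = 1 + v₂ s := by rw [hv₂]; ring
    rw [e1, e2, hck]
    linear_combination (2 * Real.pi * I) * σ s ^ k * hroot₂
  have h1 : 1 - s ^ k * Λ s ≠ 0 := by
    intro h
    rw [h, mul_zero] at hσid
    exact hsk hσid.symm
  have h2 : 1 - τ * σ s ^ k ≠ 0 := by
    intro h
    rw [h, mul_zero] at hmid
    exact (mul_ne_zero h2πI hσk) hmid.symm
  -- conclude
  have eσ : (σ s ^ k)⁻¹ = (s ^ k)⁻¹ - Λ s := by
    have h : σ s ^ k = s ^ k / (1 - s ^ k * Λ s) := by rw [eq_div_iff h1]; exact hσid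
    rw [h, inv_div]
    field_simp
  have em : (2 * Real.pi * I) * (m s ^ k)⁻¹ = (σ s ^ k)⁻¹ - τ := by
    have h : m s ^ k = (2 * Real.pi * I) * σ s ^ k / (1 - τ * σ s ^ k) := by
      rw [eq_div_iff h2]; exact hmid
    rw [h, inv_div]
    field_simp
  rw [em, eσ]

end Summit.Schanuel.Schanuel.Theorems
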